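import Literature.NumberTheory.Congruences.WolstenholmePrimePower
import Mathlib.NumberTheory.Padics.PadicVal.Basic
import Mathlib.Data.Nat.Factorization.Basic
import Mathlib.Data.Nat.Choose.Basic
import Mathlib.Tactic
import HarnessLib

/-!
# The weak one-block congruences `∏_{t(p^a)} (px + t) ≡ ∏ t` modulo `p^{a+1}` (odd `p`) and modulo `2^a` (`p = 2`)

Topic `Literature/NumberTheory/Congruences`, namespace `Literature.NumberTheory.Congruences.JacobsthalWeak`
(files `JacobsthalWeakBlockCongruence` → `JacobsthalWeakBlockPolynomial` → `JacobsthalWeakBinomialCongruence`).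
Everything here is PROVED (theorems only; no definitions, no named facts). HONEST FRAMING (cell pub-zeta5, D2 lens):
classical `p`-adic congruences for binomial coefficients at the primes `p = 2, 3` which the tree's `Jacobsthal*`
files (prime `p ≥ 5`, modulus `p^{3+v_p(a)+v_p(b)+v_p(a−b)}`) exclude; nothing about `ζ(5)` or any
irrationality statement. Downstream use: Osburn–Sahu–Straub's Theorem 1.3 (`AperyGaussCongruences.oss2016_theorem13`,
the supercongruence `s₁₈(mp^r) ≡ s₁₈(mp^{r−1}) (mod p^{2r})` for ALL primes), whose printed proof says:
«For `p = 3`, congruence (41) of Lemma [Jacobsthal] only holds modulo `p^{r+s+min(r,s)−1}` … The case `p = 2`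
requires some more attention. In that case, the counterpart of congruence (41) is
`C(2^r a, 2^s b)/C(2^{r−1} a, 2^{s−1} b) ≡ ε (mod 2^{r+s+min(r,s)−2})` with `ε = −1`, if `2^{r−1}a ≡ 0`,
`2^{s−1}b ≡ 1` modulo `2`, and `ε = 1` otherwise» [OsburnSahuStraub2016, §2, proof of Theorem 1.3]; and
[Straub2014] Lemma 5.1: «`C(ap, bp)/C(a, b) ≡ ε (mod p^q)` (41), where `q` is the power of `p` dividing
`p³ab(a−b)/12` and where `ε = 1`, unless `p = 2` and `(a, b) ≡ (0, 1)` modulo `2` in which case `ε = −1`».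
For `p = 3` the factor `1/12` costs one power of `p`, for `p = 2` two: these files prove exactly the moduli
`p^{2+v_p(a)+v_p(b)+v_p(a−b)}` (every odd prime `p`) and `2^{1+v_2(a)+v_2(b)+v_2(a−b)}`.

## Route (the tree's `Jacobsthal*` route, one prime power lower; NOT the printed `p`-adic proofs)

Exactly as in `JacobsthalBlockCongruence.lean` (p ≥ 5), with `f(x) = ∏_{t ∈ t(p^a)} (x − t) = Σ_k A_k x^k` and
`∏_{t(p^a)} (px + t) = f(−px)` (`#t(p^a)` even), the claim `∏ (px + t) ≡ ∏ t (mod p^{a+e} ℤ[x])` is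
`p^{a+e} ∣ p^k A_k` for every `k ≥ 1`; here `e = 1` for odd `p` and `e = 0` for `p = 2` (`a ≥ 2`), and BOTH the
linear and the higher coefficients come from BAUER's identical congruence alone (Hardy–Wright Thms 126/127, tree
`BauerWolstenholme.exists_sub_pow_eq_C_mul` / `Bauer.map_prod_filter_coprime_two_pow`):
`f ≡ (x^{p−1} − 1)^{p^{a−1}} (mod p^a)` (odd `p`), `f ≡ (x² − 1)^{2^{a−2}} (mod 2^a)`: a coefficient `A_k` with
`(p−1) ∤ k` is `≡ 0 (mod p^a)` — this covers `k = 1` for every odd `p` (no Leudesdorf / Wolstenholme needed at this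
precision) — and `A_{(p−1)j} ≡ ± C(p^{a−1}, j)` with `p^{a−1−v_p(j)} ∣ C(p^{a−1}, j)` and `(p−1)j ≥ 2j ≥ 1 + j ≥
2 + v_p(j) − …`, precisely `(p−1)j + (a−1−v_p(j)) ≥ a + 1` since `v_p(j) ≤ j − 1`; for `p = 2`:
`2j + (a−2−v_2(j)) ≥ a`.

## Main statements

* `pow_dvd_pow_mul_coeff_odd` — `p` odd, `a ≥ 1`, `k ≥ 1`: `p^{a+1} ∣ p^k · [x^k] ∏_{t(p^a)} (x − t)`.
* `exists_prod_C_mul_X_add_C_eq_odd` — `p` odd, `a ≥ 1`: `∏_{t(p^a)} (px + t) = ∏ t + p^{a+1} H(x)`, `H ∈ ℤ[x]`.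
* `pow_dvd_pow_mul_coeff_two`, `exists_prod_C_mul_X_add_C_eq_two` — the same for `p = 2`, `a ≥ 2`, modulus `2^a`.

References: [Straub2014] Lemma 5.1 (41); [OsburnSahuStraub2016] §2 (proof of Theorem 1.3); [HardyWright2008]
Thms 126–127 (via the tree); [Mestrovic2011] §6 (34) and Remark 15 (the names Jacobsthal–Kazandzidis).
Adapted from the tree's `JacobsthalBlockCongruence.lean` (denom-engine-d2 g47), whose private helpers are
re-proved here.
-/

noncomputable section

open Polynomial Finset
open scoped Nat

namespace Literature.NumberTheory.Congruences.JacobsthalWeak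

/-! ### §1. Polynomial helpers -/

/-- Coefficients of `f(cX)`: `[X^k] f(cX) = c^k [X^k] f`. [folklore] -/
private theorem coeff_comp_C_mul_X {R : Type*} [CommSemiring R] (f : R[X]) (c : R) (k : ℕ) :
    (f.comp (C c * X)).coeff k = c ^ k * f.coeff k := by
  -- adapted from the tree's `Jacobsthal.coeff_comp_C_mul_X` (private there)
  induction f using Polynomial.induction_on' with
  | add f g hf hg => rw [add_comp, coeff_add, coeff_add, hf, hg, mul_add]
  | monomial n a =>
    rw [← C_mul_X_pow_eq_monomial, mul_comp, C_comp, X_pow_comp, mul_pow, ← C_pow, ← mul_assoc,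
      ← C_mul, coeff_C_mul_X_pow, coeff_C_mul_X_pow]
    split_ifs with h
    · subst h; ring
    · rw [mul_zero]

/-- A polynomial in `X^q` has no coefficient in a degree not divisible by `q`: here `(X^q − 1)^N`.
[folklore] -/
private theorem coeff_X_pow_sub_one_pow_eq_zero {R : Type*} [CommRing R] {q : ℕ} (hq : 0 < q) (N : ℕ)
    {j : ℕ} (hj : ¬ q ∣ j) : (((X : R[X]) ^ q - 1) ^ N).coeff j = 0 := by
  -- adapted from the tree's `Jacobsthal.coeff_X_pow_sub_one_pow_eq_zero` (private there)
  have h : ((X : R[X]) ^ q - 1) ^ N = expand R q ((X - 1) ^ N) := by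
    rw [map_pow, map_sub, expand_X, map_one]
  rw [h, coeff_expand hq, if_neg hj]

/-- The coefficient of `X^{qt}` in `(X^q − 1)^N` is `(−1)^{N−t} C(N, t)`. [folklore] -/
private theorem coeff_X_pow_sub_one_pow_mul {R : Type*} [CommRing R] {q : ℕ} (hq : 0 < q) (N t : ℕ) :
    (((X : R[X]) ^ q - 1) ^ N).coeff (q * t) = (-1) ^ (N - t) * (N.choose t : R) := by
  -- adapted from the tree's `Jacobsthal.coeff_X_pow_sub_one_pow_mul` (private there)
  have h : ((X : R[X]) ^ q - 1) ^ N = expand R q ((X + C (-1)) ^ N) := by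
    rw [map_pow, map_add, expand_X, expand_C, C_neg, C_1, ← sub_eq_add_neg]
  rw [h, coeff_expand hq, if_pos (dvd_mul_right q t), Nat.mul_div_cancel_left t hq, coeff_X_add_C_pow]

/-- Congruence of integer polynomials modulo `n` as equality of their reductions. [folklore] -/
private theorem map_eq_map_iff_C_dvd (n : ℕ) (A B : ℤ[X]) :
    A.map (Int.castRingHom (ZMod n)) = B.map (Int.castRingHom (ZMod n)) ↔ C (n : ℤ) ∣ A - B := by
  -- adapted from the tree's `BauerWolstenholme.map_eq_map_iff_C_dvd` (private there)
  rw [C_dvd_iff_dvd_coeff, Polynomial.ext_iff]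
  refine forall_congr' fun i ↦ ?_
  rw [coeff_map, coeff_map, eq_intCast, eq_intCast, coeff_sub, ZMod.intCast_eq_intCast_iff_dvd_sub,
    ← dvd_neg, neg_sub]

section Block

variable {p : ℕ} [hp : Fact p.Prime]

omit hp in
/-- For a prime power, «prime to `p^a`» is «prime to `p`». [folklore] -/
private theorem filter_coprime_prime_pow {a : ℕ} (ha : 1 ≤ a) :
    {t ∈ range (p ^ a) | (p ^ a).Coprime t} = {t ∈ range (p ^ a) | p.Coprime t} := by
  -- adapted from the tree's `BauerWolstenholme.filter_coprime_prime_pow` (private there)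
  ext t
  simp only [mem_filter, and_congr_right_iff]
  intro _
  exact Nat.coprime_pow_left_iff (by omega) _ _

/-- `#t(p^a) = p^{a−1}(p − 1)` is even when `p` is odd (`a ≥ 1`) or when `p = 2` and `a ≥ 2`. [folklore] -/
private theorem even_card {a : ℕ} (ha : 1 ≤ a) (h : p ≠ 2 ∨ 2 ≤ a) :
    Even #{t ∈ range (p ^ a) | (p ^ a).Coprime t} := by
  have hp' := hp.out
  rw [← Nat.totient_eq_card_coprime, Nat.totient_prime_pow hp' (by omega)]
  by_cases hp2 : p = 2
  · subst hp2
    have h2 : 2 ≤ a := by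
      rcases h with h | h
      · exact absurd rfl h
      · exact h
    exact (Nat.even_pow.mpr ⟨even_two, by omega⟩).mul_right _
  · exact (hp'.even_sub_one hp2).mul_left _

/-- **The arithmetic core**: `p^{a+e} ∣ p^{qt} · C(p^{a'}, t)` whenever `t ≥ 1`, `2t ≤ qt` and `a + e ≤ a' + 2`
(here `(q, a', e) = (p−1, a−1, 1)` for odd `p` and `(2, a−2, 0)` for `p = 2`): from `t · C(p^{a'}, t) =
p^{a'} · C(p^{a'} − 1, t − 1)` one has `v_p(C(p^{a'}, t)) ≥ a' − v_p(t) ≥ a' − (t − 1)`. [folklore] -/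
private theorem pow_dvd_pow_mul_choose_prime_pow {a' t K M : ℕ} (ht : 1 ≤ t) (hK : 2 * t ≤ K)
    (hM : M ≤ a' + 2) : p ^ M ∣ p ^ K * (p ^ a').choose t := by
  have hp' := hp.out
  set N := p ^ a' with hN
  by_cases hC : N.choose t = 0
  · rw [hC, mul_zero]; exact dvd_zero _
  -- `N · C(N − 1, t − 1) = C(N, t) · t`, so `p^{a'} ∣ C(N, t) · t`
  have hid : N * (N - 1).choose (t - 1) = N.choose t * t := by
    have h := Nat.add_one_mul_choose_eq (N - 1) (t - 1)
    have hN1 : 1 ≤ N := Nat.one_le_pow _ _ hp'.pos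
    rwa [Nat.sub_add_cancel hN1, Nat.sub_add_cancel ht] at h
  have hNdvd : p ^ a' ∣ N.choose t * t := by rw [← hid]; exact Dvd.intro _ rfl
  have ht0 : t ≠ 0 := by omega
  have hv : a' ≤ padicValNat p (N.choose t) + padicValNat p t := by
    rw [← padicValNat.mul hC ht0]
    exact (padicValNat_dvd_iff_le (mul_ne_zero hC ht0)).mp hNdvd
  -- `v_p(t) < t`
  have hvt : padicValNat p t < t := by
    have h1 : p ^ padicValNat p t ≤ t := Nat.le_of_dvd (by omega) pow_padicValNat_dvd
    have h2 : padicValNat p t < p ^ padicValNat p t := Nat.lt_pow_self hp'.one_lt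
    omega
  rw [padicValNat_dvd_iff_le (mul_ne_zero (pow_ne_zero _ hp'.ne_zero) hC), padicValNat.mul
    (pow_ne_zero _ hp'.ne_zero) hC, padicValNat.prime_pow]
  omega

/-- **All coefficients of positive degree, odd `p`**: for an odd prime `p`, `a ≥ 1`, `k ≥ 1`,
`p^{a+1} ∣ p^k · [x^k] ∏_{t(p^a)} (x − t)` — from Bauer's identical congruence `f(x) ≡ (x^{p−1} − 1)^{p^{a−1}}
(mod p^a)` (Hardy–Wright Thm 126, tree `BauerWolstenholme.exists_sub_pow_eq_C_mul`): a coefficient of degree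
`k` with `(p−1) ∤ k` (in particular `k = 1`) is `≡ 0 (mod p^a)`, and `[x^{(p−1)t}] = ± C(p^{a−1}, t)` with
`(p−1)t + a − 1 − v_p(t) ≥ a + 1`. One power of `p` weaker than the tree's `Jacobsthal.pow_dvd_pow_mul_coeff_of_pos`
(`p ≥ 5`, modulus `p^{a+2}`), but valid at `p = 3`. [cite: HardyWright2008, Thm 126 (8.5.4)]
[cite: Straub2014, Lemma 5.1 (41) (the case p = 3)] -/
theorem pow_dvd_pow_mul_coeff_odd (hp2 : p ≠ 2) {a : ℕ} (ha : 1 ≤ a) {k : ℕ} (hk : 1 ≤ k) :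
    (p : ℤ) ^ (a + 1) ∣
      (p : ℤ) ^ k * (∏ t ∈ {t ∈ range (p ^ a) | (p ^ a).Coprime t}, (X - C (t : ℤ))).coeff k := by
  -- adapted from the tree's `Jacobsthal.pow_dvd_pow_mul_coeff` (p ≥ 5, modulus p^{a+2})
  have hp' := hp.out
  have hp3 : 3 ≤ p := by
    have := hp'.two_le; omega
  obtain ⟨H, hH⟩ := BauerWolstenholme.exists_sub_pow_eq_C_mul (p := p) hp2 ha
  obtain ⟨a, rfl⟩ : ∃ a', a = a' + 1 := ⟨a - 1, by omega⟩
  rw [Nat.add_sub_cancel] at hH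
  have hf : (∏ t ∈ {t ∈ range (p ^ (a + 1)) | (p ^ (a + 1)).Coprime t}, (X - C (t : ℤ))).coeff k =
      (((X : ℤ[X]) ^ (p - 1) - 1) ^ (p ^ a)).coeff k + (p : ℤ) ^ (a + 1) * H.coeff k := by
    have := congrArg (fun P : ℤ[X] => P.coeff k) hH
    simp only [coeff_sub, coeff_C_mul] at this
    linarith
  rw [hf, mul_add]
  refine dvd_add ?_ ⟨(p : ℤ) ^ (k - 1) * H.coeff k, ?_⟩
  swap
  · rw [← mul_assoc, ← mul_assoc, ← pow_add, ← pow_add, show a + 1 + 1 + (k - 1) = k + (a + 1) by omega]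
  by_cases hdvd : (p - 1) ∣ k
  · -- `k = (p − 1) t`, `t ≥ 1`
    obtain ⟨t, rfl⟩ := hdvd
    have ht : 1 ≤ t := by
      rcases Nat.eq_zero_or_pos t with h0 | h0
      · subst h0; omega
      · exact h0
    rw [coeff_X_pow_sub_one_pow_mul (by omega), ← mul_assoc, mul_comm ((p : ℤ) ^ _), mul_assoc]
    refine Dvd.dvd.mul_left ?_ _
    have h2t : 2 * t ≤ (p - 1) * t := Nat.mul_le_mul_right t (by omega)
    have h := pow_dvd_pow_mul_choose_prime_pow (p := p) (a' := a) (M := a + 1 + 1) ht h2t (by omega)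
    have := Int.natCast_dvd_natCast.mpr h
    push_cast at this
    exact this
  · rw [coeff_X_pow_sub_one_pow_eq_zero (by omega) _ hdvd, mul_zero]
    exact dvd_zero _

/-- **One block, odd `p`**: for an odd prime `p` and `a ≥ 1`,
`∏_{t ∈ t(p^a)} (p x + t) = ∏_{t ∈ t(p^a)} t + p^{a+1} H(x)` for an integer polynomial `H` — i.e.
`∏ (px + t) ≡ ∏ t (mod p^{a+1} ℤ[x])`; at `p = 3` this is the block congruence behind [Straub2014] (41) with its
factor `1/12` (the tree's `Jacobsthal.exists_prod_C_mul_X_add_C_eq` is the modulus-`p^{a+2}` version for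
`p ≥ 5`). [cite: Straub2014, Lemma 5.1 (41) (the case p = 3)] [cite: HardyWright2008, Thm 126] -/
theorem exists_prod_C_mul_X_add_C_eq_odd (hp2 : p ≠ 2) {a : ℕ} (ha : 1 ≤ a) :
    ∃ H : ℤ[X], ∏ t ∈ {t ∈ range (p ^ a) | (p ^ a).Coprime t}, (C (p : ℤ) * X + C (t : ℤ)) =
      C (∏ t ∈ {t ∈ range (p ^ a) | (p ^ a).Coprime t}, (t : ℤ)) + C ((p : ℤ) ^ (a + 1)) * H := by
  -- adapted from the tree's `Jacobsthal.exists_prod_C_mul_X_add_C_eq` (p ≥ 5, modulus p^{a+2})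
  have hp' := hp.out
  set S := {t ∈ range (p ^ a) | (p ^ a).Coprime t} with hS
  set f : ℤ[X] := ∏ t ∈ S, (X - C (t : ℤ)) with hf
  -- `∏ (px + t) = f(−px)` since `#S` is even
  have hB : ∏ t ∈ S, (C (p : ℤ) * X + C (t : ℤ)) = f.comp (C (-(p : ℤ)) * X) := by
    rw [hf, Polynomial.prod_comp]
    have : ∀ t ∈ S, (X - C (t : ℤ)).comp (C (-(p : ℤ)) * X) = (-1) * (C (p : ℤ) * X + C (t : ℤ)) := by
      intro t _
      rw [sub_comp, X_comp, C_comp, C_neg]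
      ring
    rw [prod_congr rfl this, prod_mul_distrib, prod_const,
      (even_card (p := p) ha (Or.inl hp2)).neg_one_pow, one_mul]
  -- every coefficient of positive degree of `f(−px)` is divisible by `p^{a+1}`
  have hdvd : C ((p : ℤ) ^ (a + 1)) ∣ f.comp (C (-(p : ℤ)) * X) - C ((f.comp (C (-(p : ℤ)) * X)).coeff 0) := by
    rw [C_dvd_iff_dvd_coeff]
    intro i
    rw [coeff_sub, coeff_C]
    rcases Nat.eq_zero_or_pos i with h0 | hi
    · subst h0; simp
    · rw [if_neg (by omega), sub_zero, coeff_comp_C_mul_X, neg_pow, mul_assoc, mul_comm ((-1 : ℤ) ^ i)]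
      exact (pow_dvd_pow_mul_coeff_odd (p := p) hp2 ha hi).mul_right _
  obtain ⟨H, hH⟩ := hdvd
  refine ⟨H, ?_⟩
  have h0 : (f.comp (C (-(p : ℤ)) * X)).coeff 0 = ∏ t ∈ S, (t : ℤ) := by
    rw [← hB, coeff_zero_eq_eval_zero, eval_prod]
    refine prod_congr rfl fun t _ => ?_
    simp
  rw [hB, ← h0]
  linear_combination hH

end Block

/-! ### §3. The prime `2` -/

section Two

/-- Bauer's congruence for `p = 2` (Hardy–Wright Thm 127, (8.5.6); tree `Bauer.map_prod_filter_coprime_two_pow`)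
as an identity in `ℤ[x]`: `∏_{t(2^a)} (x − t) − (x² − 1)^{2^{a−2}} = 2^a h(x)`, `a ≥ 2`.
[cite: HardyWright2008, Thm 127 (8.5.6)] -/
theorem exists_sub_pow_eq_C_mul_two {a : ℕ} (ha : 2 ≤ a) :
    ∃ H : ℤ[X], ∏ t ∈ {t ∈ range (2 ^ a) | (2 ^ a).Coprime t}, (X - C (t : ℤ)) -
        (X ^ 2 - 1) ^ (2 ^ (a - 2)) = C ((2 : ℤ) ^ a) * H := by
  have h := Bauer.map_prod_filter_coprime_two_pow ha
  rw [← filter_coprime_prime_pow (p := 2) (by omega : 1 ≤ a)] at h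
  obtain ⟨H, hH⟩ := (map_eq_map_iff_C_dvd (2 ^ a) _ _).mp h
  exact ⟨H, by rw [hH, Nat.cast_pow, Nat.cast_ofNat]⟩

/-- **All coefficients of positive degree, `p = 2`**: for `a ≥ 2` and `k ≥ 1`,
`2^a ∣ 2^k · [x^k] ∏_{t(2^a)} (x − t)` — from Bauer's congruence `f ≡ (x² − 1)^{2^{a−2}} (mod 2^a)`: odd-degree
coefficients vanish modulo `2^a`, and `[x^{2t}] = ± C(2^{a−2}, t)` with `2t + a − 2 − v_2(t) ≥ a`.
[cite: HardyWright2008, Thm 127 (8.5.6)] [cite: Straub2014, Lemma 5.1 (41) (the case p = 2)] -/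
theorem pow_dvd_pow_mul_coeff_two {a : ℕ} (ha : 2 ≤ a) {k : ℕ} (hk : 1 ≤ k) :
    (2 : ℤ) ^ a ∣
      (2 : ℤ) ^ k * (∏ t ∈ {t ∈ range (2 ^ a) | (2 ^ a).Coprime t}, (X - C (t : ℤ))).coeff k := by
  obtain ⟨H, hH⟩ := exists_sub_pow_eq_C_mul_two ha
  obtain ⟨a, rfl⟩ : ∃ a', a = a' + 2 := ⟨a - 2, by omega⟩
  rw [Nat.add_sub_cancel] at hH
  have hf : (∏ t ∈ {t ∈ range (2 ^ (a + 2)) | (2 ^ (a + 2)).Coprime t}, (X - C (t : ℤ))).coeff k =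
      (((X : ℤ[X]) ^ 2 - 1) ^ (2 ^ a)).coeff k + (2 : ℤ) ^ (a + 2) * H.coeff k := by
    have := congrArg (fun P : ℤ[X] => P.coeff k) hH
    simp only [coeff_sub, coeff_C_mul] at this
    linarith
  rw [hf, mul_add]
  refine dvd_add ?_ ⟨(2 : ℤ) ^ k * H.coeff k, by ring⟩
  by_cases hdvd : 2 ∣ k
  · obtain ⟨t, rfl⟩ := hdvd
    have ht : 1 ≤ t := by omega
    rw [coeff_X_pow_sub_one_pow_mul (by omega), ← mul_assoc, mul_comm ((2 : ℤ) ^ _), mul_assoc]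
    refine Dvd.dvd.mul_left ?_ _
    have h := pow_dvd_pow_mul_choose_prime_pow (p := 2) (a' := a) (K := 2 * t) (M := a + 2) ht le_rfl le_rfl
    have := Int.natCast_dvd_natCast.mpr h
    push_cast at this
    exact this
  · rw [coeff_X_pow_sub_one_pow_eq_zero (by omega) _ hdvd, mul_zero]
    exact dvd_zero _

/-- **One block, `p = 2`**: for `a ≥ 2`, `∏_{t ∈ t(2^a)} (2x + t) = ∏_{t ∈ t(2^a)} t + 2^a H(x)` for an integer
polynomial `H`, i.e. `∏ (2x + t) ≡ ∏ t (mod 2^a ℤ[x])` — the block congruence behind the `p = 2` case of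
[Straub2014] (41) («`ε = −1` if `(a, b) ≡ (0, 1)` modulo 2»; the sign appears only for an odd number of blocks, in
`JacobsthalWeakBinomialCongruence`). [cite: Straub2014, Lemma 5.1 (41) (the case p = 2)]
[cite: HardyWright2008, Thm 127] -/
theorem exists_prod_C_mul_X_add_C_eq_two {a : ℕ} (ha : 2 ≤ a) :
    ∃ H : ℤ[X], ∏ t ∈ {t ∈ range (2 ^ a) | (2 ^ a).Coprime t}, (C (2 : ℤ) * X + C (t : ℤ)) =
      C (∏ t ∈ {t ∈ range (2 ^ a) | (2 ^ a).Coprime t}, (t : ℤ)) + C ((2 : ℤ) ^ a) * H := by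
  set S := {t ∈ range (2 ^ a) | (2 ^ a).Coprime t} with hS
  set f : ℤ[X] := ∏ t ∈ S, (X - C (t : ℤ)) with hf
  have hB : ∏ t ∈ S, (C (2 : ℤ) * X + C (t : ℤ)) = f.comp (C (-(2 : ℤ)) * X) := by
    rw [hf, Polynomial.prod_comp]
    have : ∀ t ∈ S, (X - C (t : ℤ)).comp (C (-(2 : ℤ)) * X) = (-1) * (C (2 : ℤ) * X + C (t : ℤ)) := by
      intro t _
      rw [sub_comp, X_comp, C_comp, C_neg]
      ring
    have hev : Even #S := by
      have := even_card (p := 2) (a := a) (by omega) (Or.inr ha)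
      simpa [hS] using this
    rw [prod_congr rfl this, prod_mul_distrib, prod_const, hev.neg_one_pow, one_mul]
  have hdvd : C ((2 : ℤ) ^ a) ∣ f.comp (C (-(2 : ℤ)) * X) - C ((f.comp (C (-(2 : ℤ)) * X)).coeff 0) := by
    rw [C_dvd_iff_dvd_coeff]
    intro i
    rw [coeff_sub, coeff_C]
    rcases Nat.eq_zero_or_pos i with h0 | hi
    · subst h0; simp
    · rw [if_neg (by omega), sub_zero, coeff_comp_C_mul_X, neg_pow, mul_assoc, mul_comm ((-1 : ℤ) ^ i)]
      exact (pow_dvd_pow_mul_coeff_two ha hi).mul_right _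
  obtain ⟨H, hH⟩ := hdvd
  refine ⟨H, ?_⟩
  have h0 : (f.comp (C (-(2 : ℤ)) * X)).coeff 0 = ∏ t ∈ S, (t : ℤ) := by
    rw [← hB, coeff_zero_eq_eval_zero, eval_prod]
    refine prod_congr rfl fun t _ => ?_
    simp
  rw [hB, ← h0]
  linear_combination hH

end Two

end Literature.NumberTheory.Congruences.JacobsthalWeak

end
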